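import Summits.QuantumFields.YangMills.Theorems.BalabanUVNodesN15KingModelReflectionPositivityLaw

/-!
# BalabanUVNodes ∕ N15 — THE KING-MODEL RUNG (PART Ϻ-r): REFLECTION POSITIVITY OF `μ_∞` IN CHARACTERISTIC-FUNCTION FORM —
# `∫ conj(θF)·F dμ_∞ ≥ 0` (real and non-negative) for `F = Σ_k a_k e^{iφ(f_k)}`, COMPLEX coefficients, `f_k` supported in `{z_ν ≥ 0}` (the Osterwalder–Schrader form of the axiom)
# (Track A, DAG node N15 = NE2; FAN-OUT v1.1 §N15 s3 «KING-MODEL RUNG»; uses parts Ϻ-n∕o (`μ_∞`, Gaussian laws of field sums, the reflected Gram matrix and its entrywise exponential); count-neutral)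

HONEST FRAMING.  Count-neutral (cell `pub-ymgap`, seat `pub-ymgap-dag-n15-e` g35; `--supports stmt-QuantumFields-27366 --as helper` = K3⁸).  King's `A = 0`, `g = 0` model
([King1986] C. King, Commun. Math. Phys. **102** (1986) 649–677).  Part Ϻ-o proved reflection positivity of the infinite-volume block-field law `μ_∞` on REAL exponentials.
THIS FILE gives the standard OSTERWALDER–SCHRADER form with COMPLEX exponentials `e^{iφ(f)}` and complex coefficients: for `F = Σ_k a_k e^{iφ(f_k)}` (`a_k ∈ ℂ`, `f_k` supported in
`s ⊆ {z_ν ≥ 0}`, `φ(f) = Σ_{z∈s}f(z)φ(z)`) and `θF = Σ_k a_k e^{iφ_θ(f_k)}` (`φ_θ(f) = Σ f(z)φ(θz)`, `θz = (z_⊥, −z_ν−1)`):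
★★★ `∫ conj(θF)·F dμ_∞ = Σ_{k,l} conj(b_k) b_l e^{M_{kl}}` with `b_k = a_k e^{−V_k∕2}` and part Ϻ-o's symmetric PSD matrix `M`, a REAL NON-NEGATIVE number (characteristic function
of the centred Gaussian `φ(f_l) − φ_θ(f_k)`: `e^{−Var∕2} = e^{−V_k∕2}e^{−V_l∕2}e^{+M_{kl}}`; then a Hermitian form of the real symmetric PSD matrix `(e^{M_{kl}})`).  NOT Bałaban's objects;
NOT a node discharge; nothing continuum-Yang–Mills ∕ `ℝ⁴` ∕ Clay; the OS RECONSTRUCTION (Hilbert space, transfer operator) is NOT typed here.  0 `sorry`, 0 def; standard axioms.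

WHAT THIS FILE PROVES (kernel).  §1 `integral_cexp_I_fieldSum` (`∫e^{iΣc_jφ(p_j)}dμ_∞ = e^{−Var∕2}`), `integrable_cexp_I_fieldSum`.  §2 `hermForm_re_eq`, `hermForm_im_eq_zero`, ★ `hermForm_nonneg_of_posSemidef`
(a complex Hermitian form of a real symmetric PSD matrix is real `≥ 0`).  §3 ★★ `integral_conj_reflect_mul_eq` (the OS pairing in closed form), ★★★ **`kingFieldInf_os_reflection_positive`**
(`0 ≤ re`, `im = 0`).

HONEST SCOPE.  King's free `K = |Ω| = ∞` block field; observables = finite complex-exponential sums of finitely supported field sums (the standard OS class).  N15 untouched; counts unmoved.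
Locators (use): [King1986] Thm 2.1 (2.22) p.654, Thm 3.3 (3.6) p.655; [GlimmJaffe1987] Thm 6.2.2; [OsterwalderSchrader1973] axiom (E2).
-/

noncomputable section

open scoped BigOperators Topology ComplexConjugate
open Filter MeasureTheory ProbabilityTheory Finset Complex

namespace Summit.QuantumFields.YangMills.BalabanUVNodes.N15KingModelRung.InfiniteVolume

open Summit.QuantumFields.YangMills.BalabanUVNodes.N15KingModelRung.OptimalDecay

variable {d : ℕ}

/-! ## §1 Characteristic functions of field sums under `μ_∞` -/

/-- `∫ e^{i·Σ_{j∈T}c_jφ(p_j)} dμ_∞ = exp(−½ Σ_{j,j′}c_jc_{j′}S₂^{ℝ}(p_{j′}−p_j))` (characteristic function of a centred Gaussian at `t = 1`). [folklore] -/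
theorem integral_cexp_I_fieldSum {m2 : ℝ} (hm : 0 < m2) {J : Type*} (T : Finset J) (p : J → Fin (d + 1) → ℤ) (c : J → ℝ) :
    ∫ ω, Complex.exp (((∑ j ∈ T, c j * ω (p j) : ℝ) : ℂ) * I) ∂kingFieldInf m2
      = Complex.exp (-(((∑ j ∈ T, ∑ j' ∈ T, c j * c j' * kingS2Inf m2 (p j' - p j)) / 2 : ℝ) : ℂ)) := by
  haveI := isProbabilityMeasure_kingFieldInf (d := d) hm
  have hY := hasGaussianLaw_fieldSum hm T p c
  have hlaw := hY.map_eq_gaussianReal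
  have hchar := charFun_gaussianReal (μ := ∫ ω, (∑ j ∈ T, c j * ω (p j)) ∂kingFieldInf m2)
    (v := (Var[fun ω : (Fin (d + 1) → ℤ) → ℝ => ∑ j ∈ T, c j * ω (p j); kingFieldInf m2]).toNNReal) 1
  have hcf : charFun ((kingFieldInf m2).map fun ω : (Fin (d + 1) → ℤ) → ℝ => ∑ j ∈ T, c j * ω (p j)) 1
      = ∫ ω, Complex.exp (((∑ j ∈ T, c j * ω (p j) : ℝ) : ℂ) * I) ∂kingFieldInf m2 := by
    rw [charFun_apply_real, integral_map hY.aemeasurable]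
    · simp only [Complex.ofReal_one, one_mul]
    · exact (by fun_prop : Continuous fun x : ℝ => Complex.exp (((1 : ℝ) : ℂ) * (x : ℂ) * I)).aestronglyMeasurable
  rw [← hlaw, hcf] at hchar
  simp only [Complex.ofReal_one, one_mul, one_pow, mul_one] at hchar
  rw [hchar, integral_fieldSum hm T p c, Real.coe_toNNReal _ (variance_nonneg _ _), variance_fieldSum hm T p c]
  congr 1
  push_cast
  ring

/-- `e^{iΣc_jφ(p_j)}` is integrable (norm one on a probability space). [folklore] -/
theorem integrable_cexp_I_fieldSum {m2 : ℝ} (hm : 0 < m2) {J : Type*} (T : Finset J) (p : J → Fin (d + 1) → ℤ) (c : J → ℝ) :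
    Integrable (fun ω : (Fin (d + 1) → ℤ) → ℝ => Complex.exp (((∑ j ∈ T, c j * ω (p j) : ℝ) : ℂ) * I)) (kingFieldInf m2) := by
  haveI := isProbabilityMeasure_kingFieldInf (d := d) hm
  have hY : Measurable fun ω : (Fin (d + 1) → ℤ) → ℝ => ∑ j ∈ T, c j * ω (p j) :=
    Finset.measurable_sum _ fun j _ => (measurable_const.mul (measurable_pi_apply (p j)))
  have hmeas : Measurable fun ω : (Fin (d + 1) → ℤ) → ℝ => Complex.exp (((∑ j ∈ T, c j * ω (p j) : ℝ) : ℂ) * I) :=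
    Complex.measurable_exp.comp ((Complex.measurable_ofReal.comp hY).mul_const I)
  refine (integrable_const (1 : ℝ)).mono' hmeas.aestronglyMeasurable (Eventually.of_forall fun ω => ?_)
  rw [Complex.norm_exp_ofReal_mul_I]

/-! ## §2 A complex Hermitian form of a real symmetric PSD matrix is real and non-negative -/

section Herm

variable {ι : Type*} [Fintype ι]

/-- The real part of `Σ_{k,l} conj(b_k) b_l E_{kl}` (`E` real): `Σ (Re b_k Re b_l + Im b_k Im b_l) E_{kl}`. [folklore] -/
theorem hermForm_re_eq (E : Matrix ι ι ℝ) (b : ι → ℂ) :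
    (∑ k, ∑ l, conj (b k) * b l * (E k l : ℂ)).re = ∑ k, ∑ l, ((b k).re * (b l).re + (b k).im * (b l).im) * E k l := by
  rw [Complex.re_sum]
  refine Finset.sum_congr rfl fun k _ => ?_
  rw [Complex.re_sum]
  refine Finset.sum_congr rfl fun l _ => ?_
  simp only [Complex.mul_re, Complex.conj_re, Complex.conj_im, Complex.ofReal_re, Complex.ofReal_im, Complex.mul_im]
  ring

/-- The imaginary part of `Σ_{k,l} conj(b_k) b_l E_{kl}` VANISHES for a real SYMMETRIC `E`. [folklore] -/
theorem hermForm_im_eq_zero {E : Matrix ι ι ℝ} (hE : E.IsSymm) (b : ι → ℂ) : (∑ k, ∑ l, conj (b k) * b l * (E k l : ℂ)).im = 0 := by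
  have h : (∑ k, ∑ l, conj (b k) * b l * (E k l : ℂ)).im = ∑ k, ∑ l, ((b k).re * (b l).im - (b k).im * (b l).re) * E k l := by
    rw [Complex.im_sum]
    refine Finset.sum_congr rfl fun k _ => ?_
    rw [Complex.im_sum]
    refine Finset.sum_congr rfl fun l _ => ?_
    simp only [Complex.mul_re, Complex.conj_re, Complex.conj_im, Complex.ofReal_re, Complex.ofReal_im, Complex.mul_im]
    ring
  rw [h]
  -- the antisymmetric coefficient against the symmetric matrix sums to zero
  have hswap : ∑ k, ∑ l, ((b k).re * (b l).im - (b k).im * (b l).re) * E k l = ∑ k, ∑ l, ((b l).re * (b k).im - (b l).im * (b k).re) * E l k := by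
    rw [Finset.sum_comm]
  have hsym : ∑ k, ∑ l, ((b l).re * (b k).im - (b l).im * (b k).re) * E l k = -∑ k, ∑ l, ((b k).re * (b l).im - (b k).im * (b l).re) * E k l := by
    rw [← Finset.sum_neg_distrib]
    refine Finset.sum_congr rfl fun k _ => ?_
    rw [← Finset.sum_neg_distrib]
    refine Finset.sum_congr rfl fun l _ => ?_
    rw [hE.apply l k]
    ring
  linarith [hswap.trans hsym]

/-- ★ **A complex Hermitian form of a real symmetric PSD matrix is a non-negative real**: `0 ≤ Re Σ conj(b_k)b_lE_{kl}` and `Im = 0`. [folklore] -/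
theorem hermForm_nonneg_of_posSemidef {E : Matrix ι ι ℝ} (hE : E.PosSemidef) (b : ι → ℂ) :
    0 ≤ (∑ k, ∑ l, conj (b k) * b l * (E k l : ℂ)).re ∧ (∑ k, ∑ l, conj (b k) * b l * (E k l : ℂ)).im = 0 := by
  have hsymm : E.IsSymm := by
    have h := hE.isHermitian
    rw [Matrix.IsHermitian, Matrix.conjTranspose_eq_transpose_of_trivial] at h
    exact h
  refine ⟨?_, hermForm_im_eq_zero hsymm b⟩
  rw [hermForm_re_eq]
  have hq : ∀ x : ι → ℝ, 0 ≤ ∑ k, ∑ l, x k * x l * E k l := by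
    intro x
    have h := hE.dotProduct_mulVec_nonneg x
    have e : star x ⬝ᵥ E.mulVec x = ∑ k, ∑ l, x k * x l * E k l := by
      simp only [star_trivial, dotProduct, Matrix.mulVec, Finset.mul_sum]
      refine Finset.sum_congr rfl fun k _ => Finset.sum_congr rfl fun l _ => ?_
      ring
    rw [e] at h
    exact h
  have hsplit : ∑ k, ∑ l, ((b k).re * (b l).re + (b k).im * (b l).im) * E k l
      = (∑ k, ∑ l, (b k).re * (b l).re * E k l) + ∑ k, ∑ l, (b k).im * (b l).im * E k l := by
    rw [← Finset.sum_add_distrib]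
    refine Finset.sum_congr rfl fun k _ => ?_
    rw [← Finset.sum_add_distrib]
    refine Finset.sum_congr rfl fun l _ => ?_
    ring
  rw [hsplit]
  exact add_nonneg (hq fun k => (b k).re) (hq fun k => (b k).im)

end Herm

/-! ## §3 The Osterwalder–Schrader pairing in closed form, and its positivity -/

section OS

variable (ν : Fin (d + 1)) {ι : Type*} [Fintype ι]

/-- ★★ **THE OS PAIRING IN CLOSED FORM**: with `V_k = ΣΣf_kf_kS₂^{ℝ}`, `M_{kl} = Σ_{z,w}f_k(z)f_l(w)S₂^{ℝ}(w − θz)`: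
`∫ conj(Σ_k a_k e^{iφ_θ(f_k)})·(Σ_l a_l e^{iφ(f_l)}) dμ_∞ = Σ_{k,l} conj(a_k e^{−V_k∕2})(a_l e^{−V_l∕2}) e^{M_{kl}}`. [cite: King1986, Thm 2.1 (2.22) p.654; GlimmJaffe1987, Thm 6.2.2] -/
theorem integral_conj_reflect_mul_eq {m2 : ℝ} (hm : 0 < m2) (s : Finset (Fin (d + 1) → ℤ)) (f : ι → (Fin (d + 1) → ℤ) → ℝ) (a : ι → ℂ) :
    ∫ ω, conj (∑ k, a k * Complex.exp (((∑ z ∈ s, f k z * ω (Function.update z ν (-(z ν) - 1)) : ℝ) : ℂ) * I))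
        * (∑ l, a l * Complex.exp (((∑ z ∈ s, f l z * ω z : ℝ) : ℂ) * I)) ∂kingFieldInf m2
      = ∑ k, ∑ l, conj (a k * ((Real.exp (-((∑ z ∈ s, ∑ w ∈ s, f k z * f k w * kingS2Inf m2 (w - z)) / 2)) : ℝ) : ℂ))
          * (a l * ((Real.exp (-((∑ z ∈ s, ∑ w ∈ s, f l z * f l w * kingS2Inf m2 (w - z)) / 2)) : ℝ) : ℂ))
          * ((Real.exp (∑ z ∈ s, ∑ w ∈ s, f k z * f l w * kingS2Inf m2 (w - Function.update z ν (-(z ν) - 1))) : ℝ) : ℂ) := by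
  haveI := isProbabilityMeasure_kingFieldInf (d := d) hm
  set θ : (Fin (d + 1) → ℤ) → (Fin (d + 1) → ℤ) := fun z => Function.update z ν (-(z ν) - 1) with hθ
  set V : ι → ℝ := fun k => ∑ z ∈ s, ∑ w ∈ s, f k z * f k w * kingS2Inf m2 (w - z) with hV
  set M : ι → ι → ℝ := fun k l => ∑ z ∈ s, ∑ w ∈ s, f k z * f l w * kingS2Inf m2 (w - θ z) with hM
  -- Step 1: each cross term is the characteristic function of ONE combined field sum
  have hterm : ∀ k l, ∫ ω, conj (Complex.exp (((∑ z ∈ s, f k z * ω (θ z) : ℝ) : ℂ) * I)) * Complex.exp (((∑ z ∈ s, f l z * ω z : ℝ) : ℂ) * I) ∂kingFieldInf m2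
      = ((Real.exp (-(V k / 2)) : ℝ) : ℂ) * ((Real.exp (-(V l / 2)) : ℝ) : ℂ) * ((Real.exp (M k l) : ℝ) : ℂ) := by
    intro k l
    set p : Bool × (Fin (d + 1) → ℤ) → (Fin (d + 1) → ℤ) := fun q => if q.1 then θ q.2 else q.2 with hp
    set c : Bool × (Fin (d + 1) → ℤ) → ℝ := fun q => if q.1 then -f k q.2 else f l q.2 with hc
    have hsplit : ∀ ω : (Fin (d + 1) → ℤ) → ℝ, ∑ q ∈ Finset.univ ×ˢ s, c q * ω (p q) = -(∑ z ∈ s, f k z * ω (θ z)) + ∑ z ∈ s, f l z * ω z := by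
      intro ω
      rw [Finset.sum_product, Fintype.sum_bool]
      simp [hp, hc, Finset.sum_neg_distrib]
    have hfun : (fun ω : (Fin (d + 1) → ℤ) → ℝ => conj (Complex.exp (((∑ z ∈ s, f k z * ω (θ z) : ℝ) : ℂ) * I)) * Complex.exp (((∑ z ∈ s, f l z * ω z : ℝ) : ℂ) * I))
        = fun ω => Complex.exp (((∑ q ∈ Finset.univ ×ˢ s, c q * ω (p q) : ℝ) : ℂ) * I) := by
      funext ω
      rw [← Complex.exp_conj, map_mul, Complex.conj_ofReal, Complex.conj_I, ← Complex.exp_add, hsplit]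
      push_cast
      ring_nf
    -- the variance of the combined sum: four blocks (a real computation)
    have hvar : ∑ q ∈ Finset.univ ×ˢ s, ∑ q' ∈ Finset.univ ×ˢ s, c q * c q' * kingS2Inf m2 (p q' - p q) = V k + V l - 2 * M k l := by
      rw [Finset.sum_product, Fintype.sum_bool]
      simp only [Finset.sum_product, Fintype.sum_bool, hp, hc, if_true, Bool.false_eq_true, if_false, Finset.sum_add_distrib]
      have hAA : ∑ z ∈ s, ∑ w ∈ s, -f k z * -f k w * kingS2Inf m2 (θ w - θ z) = V k := by
        refine Finset.sum_congr rfl fun z _ => Finset.sum_congr rfl fun w _ => ?_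
        rw [hθ, kingS2Inf_reflect_sub_reflect]; ring
      have hAB : ∑ z ∈ s, ∑ w ∈ s, -f k z * f l w * kingS2Inf m2 (w - θ z) = -M k l := by
        rw [hM]
        simp only [← Finset.sum_neg_distrib]
        refine Finset.sum_congr rfl fun z _ => Finset.sum_congr rfl fun w _ => ?_
        ring
      have hBA : ∑ z ∈ s, ∑ w ∈ s, f l z * -f k w * kingS2Inf m2 (θ w - z) = -M k l := by
        rw [hM]
        simp only [← Finset.sum_neg_distrib]
        rw [Finset.sum_comm]
        refine Finset.sum_congr rfl fun z _ => Finset.sum_congr rfl fun w _ => ?_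
        rw [← kingS2Inf_neg m2 (θ z - w), neg_sub]
        ring
      have hBB : ∑ z ∈ s, ∑ w ∈ s, f l z * f l w * kingS2Inf m2 (w - z) = V l := rfl
      rw [hAA, hAB, hBA, hBB]
      ring
    rw [hfun, integral_cexp_I_fieldSum hm, hvar, ← Complex.ofReal_mul, ← Complex.ofReal_mul, ← Real.exp_add, ← Real.exp_add, Complex.ofReal_exp]
    congr 1
    push_cast
    ring
  -- Step 2: expand and integrate termwise
  have hint : ∀ k l, Integrable (fun ω : (Fin (d + 1) → ℤ) → ℝ =>
      conj (a k * Complex.exp (((∑ z ∈ s, f k z * ω (θ z) : ℝ) : ℂ) * I)) * (a l * Complex.exp (((∑ z ∈ s, f l z * ω z : ℝ) : ℂ) * I))) (kingFieldInf m2) := by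
    intro k l
    refine (integrable_const (‖a k‖ * ‖a l‖)).mono' (by fun_prop) (Eventually.of_forall fun ω => ?_)
    simp only [norm_mul, Complex.norm_conj, Complex.norm_exp_ofReal_mul_I, mul_one, le_refl]
  have hexp : (fun ω : (Fin (d + 1) → ℤ) → ℝ => conj (∑ k, a k * Complex.exp (((∑ z ∈ s, f k z * ω (θ z) : ℝ) : ℂ) * I))
        * (∑ l, a l * Complex.exp (((∑ z ∈ s, f l z * ω z : ℝ) : ℂ) * I)))
      = fun ω => ∑ k, ∑ l, conj (a k * Complex.exp (((∑ z ∈ s, f k z * ω (θ z) : ℝ) : ℂ) * I)) * (a l * Complex.exp (((∑ z ∈ s, f l z * ω z : ℝ) : ℂ) * I)) := by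
    funext ω
    rw [map_sum, Finset.sum_mul_sum]
  rw [hexp, integral_finsetSum _ fun k _ => integrable_finsetSum _ fun l _ => hint k l]
  simp_rw [integral_finsetSum _ fun l _ => hint _ l]
  refine Finset.sum_congr rfl fun k _ => Finset.sum_congr rfl fun l _ => ?_
  have e : (fun ω : (Fin (d + 1) → ℤ) → ℝ => conj (a k * Complex.exp (((∑ z ∈ s, f k z * ω (θ z) : ℝ) : ℂ) * I)) * (a l * Complex.exp (((∑ z ∈ s, f l z * ω z : ℝ) : ℂ) * I)))
      = fun ω => (conj (a k) * a l) * (conj (Complex.exp (((∑ z ∈ s, f k z * ω (θ z) : ℝ) : ℂ) * I)) * Complex.exp (((∑ z ∈ s, f l z * ω z : ℝ) : ℂ) * I)) := by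
    funext ω; rw [map_mul]; ring
  rw [e, integral_const_mul, hterm]
  simp only [map_mul, Complex.conj_ofReal, hV, hM, hθ]
  ring

/-- ★★★ **OSTERWALDER–SCHRADER REFLECTION POSITIVITY OF `μ_∞`**: for complex coefficients `a_k`, real test functions `f_k` supported in `s ⊆ {z_ν ≥ 0}`, with
`F = Σ_k a_k e^{iφ(f_k)}` and `θF = Σ_k a_k e^{iφ_θ(f_k)}` (`θz = (z_⊥, −z_ν−1)`): the pairing `∫ conj(θF)·F dμ_∞` is a NON-NEGATIVE REAL number.
[cite: King1986, Thm 2.1 (2.22) p.654, Thm 3.3 (3.6) p.655; GlimmJaffe1987, Thm 6.2.2; OsterwalderSchrader1973, (E2)] -/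
theorem kingFieldInf_os_reflection_positive {m2 : ℝ} (hm : 0 < m2) (s : Finset (Fin (d + 1) → ℤ)) (hs : ∀ z ∈ s, 0 ≤ z ν) (f : ι → (Fin (d + 1) → ℤ) → ℝ) (a : ι → ℂ) :
    0 ≤ (∫ ω, conj (∑ k, a k * Complex.exp (((∑ z ∈ s, f k z * ω (Function.update z ν (-(z ν) - 1)) : ℝ) : ℂ) * I))
        * (∑ l, a l * Complex.exp (((∑ z ∈ s, f l z * ω z : ℝ) : ℂ) * I)) ∂kingFieldInf m2).re
    ∧ (∫ ω, conj (∑ k, a k * Complex.exp (((∑ z ∈ s, f k z * ω (Function.update z ν (-(z ν) - 1)) : ℝ) : ℂ) * I))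
        * (∑ l, a l * Complex.exp (((∑ z ∈ s, f l z * ω z : ℝ) : ℂ) * I)) ∂kingFieldInf m2).im = 0 := by
  rw [integral_conj_reflect_mul_eq ν hm s f a]
  have hPSD := posSemidef_entrywiseExp (posSemidef_reflectGram ν hm s hs f)
  have h := hermForm_nonneg_of_posSemidef hPSD
    (fun k => a k * ((Real.exp (-((∑ z ∈ s, ∑ w ∈ s, f k z * f k w * kingS2Inf m2 (w - z)) / 2)) : ℝ) : ℂ))
  simpa only [Matrix.of_apply] using h

end OS

end Summit.QuantumFields.YangMills.BalabanUVNodes.N15KingModelRung.InfiniteVolume
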